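import Summits.CriticalPhenomena.PercolationContinuityZ3.Theorems.PercNearOneGluingNoHeavyLowerTailSunflowerComposition
import Mathlib.Data.Fin.Tuple.Sort
import HarnessLib
import HarnessLib.Audit

/-!
# `NoHeavyLowerTail` (crux stmt-CriticalPhenomena-4575), abstract sunflower cubic: the composition identity for CHAIN gadgets
# (multi-level modules) — `COMB_chain(G) ⟹ ★(G ∘ h)` for every substitution of monotone chain-valued block statistics

Support file (seat `prim-l12-p2` gen 9; `--supports stmt-CriticalPhenomena-4575`; sequel of `…SunflowerComposition`, p230447).  No `sorry`, no named facts.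
Memo: run/shared/lean/prim/prim-l12/prim-l12-p2/FINDING-g9-COMPOSITION.md §1, §4(e).

WHY.  The restriction-monotonicity (exchange/concavity) induction for the partition lemma of the rows G and T fails, in all data (m ≤ 5 exhaustive,
targeted search m = 6, 7), ONLY on sunflowers with a CHAIN MODULE: a block `M` on which `Φ(S ∪ T)` depends on `S ⊆ M` through a totally ordered statistic
(e.g. a threshold gadget `#(S ∩ M) ≥ 2` with the extra level `S ⊇ M ↦ ⊤`).  Boolean gadgets (`…SunflowerComposition`) are the two-level case.  This file
proves the composition identity for gadgets with any finite number of levels, so that such maps reduce to a fibre-positivity statement about their quotient.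

SETTING.  Blocks `β b` (`b : B`), heights `r b : ℕ`; a CHAIN GADGET (`CGadget`) is a monotone level statistic `lv b : Finset (β b) → Fin (r b + 1)` per block.
The quotient `G` is a sunflower on the THRESHOLD index set `Σ b, Fin (r b)`; a subset `S` of `Σ b, β b` switches on the thresholds `(b,t)` with
`t < lv b (S ∩ β b)` (`CGadget.hits`, a staircase in every block), and `G.composeC h` labels `S` by the `G`-label of this hit set (`Sunflower.composeC_lab`).
IDENTITY (`Sunflower.Zp_composeC_eq`, `…_eq_sum_ZFC`): with the LEVEL TRIPLE `L b : Fin 3 → Fin (r b + 1)` of an ordered 3-partition on block `b`,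
  `Zκ(G ∘ h) = Σ_L (Π_b n_b(L b)) · κ(G-labels of the three staircases of L) = Σ_c (Π_b n_b(c b)) · ZFC_κ(G)(c)`,
where `n_b(t)` = number of 3-partitions of block `b` with level triple `t` is invariant under relabelling the parts (`ncountC_comp_perm`), hence a function of
the SORTED triple `t ∘ Tuple.sort t` (`ncountC_eq_canon`, via `Tuple.comp_perm_comp_sort_eq_comp_sort`), and `ZFC_κ(G)(c)` is the fibre sum of `G` over the level-triple
families whose blockwise sorted form is `c`.  CONSEQUENCE (`Sunflower.Zp_composeC_nonneg_of_comb`): if all these fibre sums are `≥ 0` then `0 ≤ Zκ(G ∘ h)` for every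
chain gadget family of the given heights — the partition lemma (any row) for every sunflower with a chain-module decomposition over a COMB_chain-positive quotient.
-/

namespace Summit.CriticalPhenomena.PercolationContinuityZ3.Theorems.SunflowerPartition

open Finset

section Chain

variable {B : Type*} [Fintype B] [DecidableEq B]
variable {β : B → Type*} [∀ b, Fintype (β b)] [∀ b, DecidableEq (β b)]
variable {r : B → ℕ}

/-- A family of CHAIN GADGETS of heights `r`: on each block a monotone level statistic with values `0, …, r b`. [this work] -/
structure CGadget (β : B → Type*) [∀ b, DecidableEq (β b)] (r : B → ℕ) where
  /-- the level of a subset of block `b` -/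
  lv : ∀ b, Finset (β b) → Fin (r b + 1)
  /-- monotonicity -/
  mono : ∀ b (S T : Finset (β b)), S ⊆ T → lv b S ≤ lv b T

/-- The hit set of `S`: the thresholds `(b,t)`, `t < lv b (S ∩ β b)`, switched on by `S`. [this work] -/
def CGadget.hits (h : CGadget β r) (S : Finset (Σ b, β b)) : Finset (Σ b, Fin (r b)) :=
  univ.filter fun x => x.2.val < (h.lv x.1 (slice S x.1)).val

/-- Membership in the hit set. [this work] -/
@[simp] theorem CGadget.mem_hits (h : CGadget β r) (S : Finset (Σ b, β b)) (x : Σ b, Fin (r b)) :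
    x ∈ h.hits S ↔ x.2.val < (h.lv x.1 (slice S x.1)).val := by
  simp [CGadget.hits]

/-- The hit set is monotone. [this work] -/
theorem CGadget.hits_mono (h : CGadget β r) {S T : Finset (Σ b, β b)} (hST : S ⊆ T) : h.hits S ⊆ h.hits T := by
  intro x hx
  rw [CGadget.mem_hits] at hx ⊢
  have := h.mono x.1 _ _ (slice_mono hST x.1)
  exact lt_of_lt_of_le hx this

/-- **Chain substitution** `G ∘ h`: pull back the up-sets of the quotient `G` (a sunflower on the threshold index set) along the hit-set map. [this work] -/
def Sunflower.composeC (G : Sunflower (Σ b, Fin (r b))) (h : CGadget β r) : Sunflower (Σ b, β b) where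
  V k := univ.filter fun S => h.hits S ∈ G.V k
  upper := by
    intro k S T hST hS
    have hS' : S ∈ univ.filter fun S => h.hits S ∈ G.V k := hS
    rw [mem_filter] at hS'
    show T ∈ univ.filter fun S => h.hits S ∈ G.V k
    rw [mem_filter]
    exact ⟨mem_univ _, G.upper k (h.hits_mono hST) hS'.2⟩
  inter_eq := by
    intro k l hkl
    ext S
    simp only [mem_inter, mem_filter, mem_univ, true_and]
    have h1 := G.inter_eq k l hkl
    constructor
    · intro hS
      have : h.hits S ∈ G.V k ∩ G.V l := mem_inter.2 hS
      rw [h1] at this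
      exact mem_inter.1 this
    · intro hS
      have : h.hits S ∈ G.V 0 ∩ G.V 1 := mem_inter.2 hS
      rw [← h1] at this
      exact mem_inter.1 this

/-- Membership in the up-sets of the chain composition. [this work] -/
@[simp] theorem Sunflower.mem_composeC_V (G : Sunflower (Σ b, Fin (r b))) (h : CGadget β r) (k : Fin 3) (S : Finset (Σ b, β b)) :
    S ∈ (G.composeC h).V k ↔ h.hits S ∈ G.V k := by
  simp [Sunflower.composeC]

/-- Membership in the kernel of the chain composition. [this work] -/
@[simp] theorem Sunflower.mem_composeC_A (G : Sunflower (Σ b, Fin (r b))) (h : CGadget β r) (S : Finset (Σ b, β b)) :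
    S ∈ (G.composeC h).A ↔ h.hits S ∈ G.A := by
  simp [Sunflower.A]

/-- **The label of `S` in `G ∘ h` is the `G`-label of its hit set.** [this work] -/
theorem Sunflower.composeC_lab (G : Sunflower (Σ b, Fin (r b))) (h : CGadget β r) (S : Finset (Σ b, β b)) :
    (G.composeC h).lab S = G.lab (h.hits S) := by
  simp only [Sunflower.lab, Sunflower.mem_composeC_A, Sunflower.mem_composeC_V]

/-! ### Level triples -/

/-- The staircase family of a level-triple family `L`: the thresholds below the level of part `k`. [this work] -/
def st (L : ∀ b, Fin 3 → Fin (r b + 1)) (k : Fin 3) : Finset (Σ b, Fin (r b)) := univ.filter fun x => x.2.val < (L x.1 k).val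

/-- The kernel on the `G`-labels of the three staircases of a level-triple family. [this work] -/
def KC (κ : Fin 5 → Fin 5 → Fin 5 → ℤ) (G : Sunflower (Σ b, Fin (r b))) (L : ∀ b, Fin 3 → Fin (r b + 1)) : ℤ :=
  κ (G.lab (st L 0)) (G.lab (st L 1)) (G.lab (st L 2))

/-- The level triple of a block-index function on one block. [this work] -/
def ltrip {C : Type*} [Fintype C] {n : ℕ} (lvb : Finset C → Fin (n + 1)) (y : C → Fin 3) : Fin 3 → Fin (n + 1) :=
  fun k => lvb (fib y k)

/-- The level-triple family of a block-index family. [this work] -/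
def CGadget.ltripOf (h : CGadget β r) (x : ∀ b, β b → Fin 3) : ∀ b, Fin 3 → Fin (r b + 1) := fun b => ltrip (h.lv b) (x b)

/-- The hit set of a part is the staircase family of the level triples. [this work] -/
theorem CGadget.hits_fib (h : CGadget β r) (g : (Σ b, β b) → Fin 3) (k : Fin 3) :
    h.hits (fib g k) = st (h.ltripOf fun b y => g ⟨b, y⟩) k := by
  ext x
  rw [CGadget.mem_hits, slice_fib]
  simp [st, CGadget.ltripOf, ltrip]

/-- The partition functional of the chain composition as a sum over block-index families. [this work] -/
theorem Sunflower.Zp_composeC_eq_sum_pi (G : Sunflower (Σ b, Fin (r b))) (h : CGadget β r) (κ : Fin 5 → Fin 5 → Fin 5 → ℤ) :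
    (G.composeC h).Zp κ = ∑ x : (∀ b, β b → Fin 3), KC κ G (h.ltripOf x) := by
  rw [Sunflower.Zp_eq_sum_fib]
  simp_rw [Sunflower.composeC_lab, CGadget.hits_fib]
  exact Equiv.sum_comp (Equiv.piCurry fun (_ : B) (_ : β _) => Fin 3) (fun x => KC κ G (h.ltripOf x))

/-! ### One-block counts and their symmetry -/

section OneBlock

variable {C : Type*} [Fintype C] [DecidableEq C] {n : ℕ}

/-- The number of 3-partitions of a block with a prescribed level triple. [this work] -/
def ncountC (lvb : Finset C → Fin (n + 1)) (t : Fin 3 → Fin (n + 1)) : ℕ := #(univ.filter fun y : C → Fin 3 => ltrip lvb y = t)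

omit [DecidableEq C] in
/-- Relabelling the parts permutes the level triple. [this work] -/
theorem ltrip_perm_comp (lvb : Finset C → Fin (n + 1)) (σ : Equiv.Perm (Fin 3)) (y : C → Fin 3) :
    ltrip lvb (σ ∘ y) = ltrip lvb y ∘ σ.symm := by
  funext k
  simp only [ltrip, Function.comp_apply, fib_perm_comp]

/-- **The level-triple count is invariant under relabelling the three parts.** [this work] -/
theorem ncountC_comp_perm (lvb : Finset C → Fin (n + 1)) (t : Fin 3 → Fin (n + 1)) (τ : Equiv.Perm (Fin 3)) :
    ncountC lvb (t ∘ τ) = ncountC lvb t := by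
  unfold ncountC
  symm
  refine card_nbij' (fun y => τ.symm ∘ y) (fun y => τ ∘ y) ?_ ?_ ?_ ?_
  · intro y hy
    rw [mem_coe, mem_filter] at hy ⊢
    refine ⟨mem_univ _, ?_⟩
    rw [ltrip_perm_comp, hy.2]
    simp
  · intro y hy
    rw [mem_coe, mem_filter] at hy ⊢
    refine ⟨mem_univ _, ?_⟩
    rw [ltrip_perm_comp, hy.2]
    funext k
    simp
  · intro y _
    funext c; simp
  · intro y _
    funext c; simp

/-- The canonical (sorted) form of a level triple. [this work] -/
def canonC (t : Fin 3 → Fin (n + 1)) : Fin 3 → Fin (n + 1) := t ∘ Tuple.sort t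

omit [Fintype C] [DecidableEq C] in
/-- The canonical form is invariant under relabelling the parts. [this work] -/
theorem canonC_comp_perm (t : Fin 3 → Fin (n + 1)) (σ : Equiv.Perm (Fin 3)) : canonC (t ∘ σ) = canonC t :=
  Tuple.comp_perm_comp_sort_eq_comp_sort

/-- **The count depends only on the sorted level triple.** [this work] -/
theorem ncountC_eq_canon (lvb : Finset C → Fin (n + 1)) (t : Fin 3 → Fin (n + 1)) : ncountC lvb t = ncountC lvb (canonC t) := by
  unfold canonC
  rw [ncountC_comp_perm]

end OneBlock

/-! ### The identity -/

/-- The blockwise sorted form (class) of a level-triple family. [this work] -/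
def clsC (L : ∀ b, Fin 3 → Fin (r b + 1)) : ∀ b, Fin 3 → Fin (r b + 1) := fun b => canonC (L b)

/-- The FIBRE SUM of the quotient `G` over the level-triple families of class `c`. [this work] -/
def ZFC (κ : Fin 5 → Fin 5 → Fin 5 → ℤ) (G : Sunflower (Σ b, Fin (r b))) (c : ∀ b, Fin 3 → Fin (r b + 1)) : ℤ :=
  ∑ L ∈ (univ : Finset (∀ b, Fin 3 → Fin (r b + 1))).filter (fun L => clsC L = c), KC κ G L

/-- The number of block-index families with a prescribed level-triple family is the product of the one-block counts. [this work] -/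
theorem CGadget.card_ltripOf_eq (h : CGadget β r) (L : ∀ b, Fin 3 → Fin (r b + 1)) :
    #((univ : Finset (∀ b, β b → Fin 3)).filter fun x => h.ltripOf x = L) = ∏ b, ncountC (h.lv b) (L b) := by
  have : ((univ : Finset (∀ b, β b → Fin 3)).filter fun x => h.ltripOf x = L) =
      Fintype.piFinset fun b => (univ : Finset (β b → Fin 3)).filter fun y => ltrip (h.lv b) y = L b := by
    ext x
    simp only [mem_filter, mem_univ, true_and, Fintype.mem_piFinset]
    constructor
    · intro hx b; rw [← hx]; rfl
    · intro hx; funext b; exact hx b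
  rw [this, Fintype.card_piFinset]
  rfl

/-- **CHAIN COMPOSITION IDENTITY.** `Zκ(G ∘ h) = Σ_L (Π_b n_b(sorted L b)) · κ(G-labels of the staircases of L)`. [this work] -/
theorem Sunflower.Zp_composeC_eq (G : Sunflower (Σ b, Fin (r b))) (h : CGadget β r) (κ : Fin 5 → Fin 5 → Fin 5 → ℤ) :
    (G.composeC h).Zp κ = ∑ L : (∀ b, Fin 3 → Fin (r b + 1)), (∏ b, (ncountC (h.lv b) (clsC L b) : ℤ)) * KC κ G L := by
  rw [Sunflower.Zp_composeC_eq_sum_pi]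
  rw [← sum_fiberwise' univ h.ltripOf (fun L => KC κ G L)]
  refine sum_congr rfl fun L _ => ?_
  rw [sum_const, nsmul_eq_mul, h.card_ltripOf_eq]
  push_cast
  congr 1
  refine prod_congr rfl fun b _ => ?_
  rw [ncountC_eq_canon]
  rfl

/-- The chain composition identity regrouped by class: `Zκ(G ∘ h) = Σ_c (Π_b n_b(c b)) · ZFC_κ(G)(c)`. [this work] -/
theorem Sunflower.Zp_composeC_eq_sum_ZFC (G : Sunflower (Σ b, Fin (r b))) (h : CGadget β r) (κ : Fin 5 → Fin 5 → Fin 5 → ℤ) :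
    (G.composeC h).Zp κ =
      ∑ c ∈ (univ : Finset (∀ b, Fin 3 → Fin (r b + 1))).image clsC, (∏ b, (ncountC (h.lv b) (c b) : ℤ)) * ZFC κ G c := by
  rw [Sunflower.Zp_composeC_eq]
  rw [← sum_fiberwise_of_maps_to (s := univ) (t := univ.image clsC) (g := clsC) (fun L _ => mem_image_of_mem _ (mem_univ L))]
  refine sum_congr rfl fun c _ => ?_
  unfold ZFC
  rw [mul_sum]
  refine sum_congr rfl fun L hL => ?_
  rw [mem_filter] at hL
  rw [← hL.2]

/-- **`COMB_chain(G) ⟹ ★(G ∘ h)`**: if every class fibre sum of the quotient is nonnegative, the partition functional of every chain substitution into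
`G` (with the given heights) is nonnegative. [this work] -/
theorem Sunflower.Zp_composeC_nonneg_of_comb (G : Sunflower (Σ b, Fin (r b))) (h : CGadget β r) (κ : Fin 5 → Fin 5 → Fin 5 → ℤ)
    (hc : ∀ c : (∀ b, Fin 3 → Fin (r b + 1)), 0 ≤ ZFC κ G c) :
    0 ≤ (G.composeC h).Zp κ := by
  rw [Sunflower.Zp_composeC_eq_sum_ZFC]
  refine sum_nonneg fun c _ => mul_nonneg ?_ (hc c)
  exact prod_nonneg fun b _ => by exact_mod_cast Nat.zero_le _

/-- Row H: `0 ≤ ZH (G ∘ h)` for every chain substitution into a COMB_chain-positive quotient. [this work] -/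
theorem Sunflower.ZH_composeC_nonneg_of_comb (G : Sunflower (Σ b, Fin (r b))) (h : CGadget β r)
    (hc : ∀ c : (∀ b, Fin 3 → Fin (r b + 1)), 0 ≤ ZFC s6H G c) : 0 ≤ (G.composeC h).ZH := by
  rw [Sunflower.ZH_eq_Zp]; exact G.Zp_composeC_nonneg_of_comb h s6H hc

/-- Row G: `0 ≤ ZG (G ∘ h)` for every chain substitution into a COMB_chain-positive quotient. [this work] -/
theorem Sunflower.ZG_composeC_nonneg_of_comb (G : Sunflower (Σ b, Fin (r b))) (h : CGadget β r)
    (hc : ∀ c : (∀ b, Fin 3 → Fin (r b + 1)), 0 ≤ ZFC s6G G c) : 0 ≤ (G.composeC h).ZG := by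
  rw [Sunflower.ZG_eq_Zp]; exact G.Zp_composeC_nonneg_of_comb h s6G hc

/-- Row T: `0 ≤ ZT (G ∘ h)` for every chain substitution into a COMB_chain-positive quotient. [this work] -/
theorem Sunflower.ZT_composeC_nonneg_of_comb (G : Sunflower (Σ b, Fin (r b))) (h : CGadget β r)
    (hc : ∀ c : (∀ b, Fin 3 → Fin (r b + 1)), 0 ≤ ZFC s6T G c) : 0 ≤ (G.composeC h).ZT := by
  rw [Sunflower.ZT_eq_Zp]; exact G.Zp_composeC_nonneg_of_comb h s6T hc

end Chain

end Summit.CriticalPhenomena.PercolationContinuityZ3.Theorems.SunflowerPartition
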